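import Mathlib
import Summits.NavierStokesRegularity.NavierStokesRegularity.Theorems.FilamentSkeletonRssKelvinGateWeightedHolderGain
import Literature.Analysis.UnboundedOperators.HeatIteratedDerivBounds
import Literature.Analysis.UnboundedOperators.HeatExtensionDecay

/-!
# Route `FilamentSkeletonRss` · cruxes `TransverseReductionRJ` (stmt-21221, aside) / `TransverseReduction1A` (stmt-27414) —
# line `kelvin_gate`: WEIGHTED HÖLDER GAIN OF THE SECOND DERIVATIVE under the heat flow

Helper file (theorems only, `--as helper`).  HONEST FRAMING: analysis bookkeeping for a HYPOTHETICAL filament-type rotating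
self-similar blow-up route; nothing here bears on Navier–Stokes regularity; no stub is proved here.

Continuation of `…KelvinGateWeightedHolderGain`.  With `c = 2^{n/2}`, `c′ = 1 + 2c`:

* `weight_norm_fderiv_fderiv_heatExtension_le_of_local_holder` — for continuous `g` with `(1+|z|)‖g‖ ≤ A₀` and `⟨x⟩`-weighted
  local `β`-modulus `A₁` (`(1+|x|)‖g(z) − g(x)‖ ≤ A₁|z − x|^β` for `2|z − x| ≤ 1+|x|`), and `t > 0`,
  `(1+|x|)‖D²e^{tΔ}g(x)‖ ≤ (2c (t/2)^{-1/2} + √2 c c′)(c (t/2)^{-1/2} c′ t^{β/2} A₁ + 4√2 c c′ A₀)` — i.e. `O(t^{-1+β/2})` as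
  `t → 0`: semigroup split `e^{tΔ} = e^{(t/2)Δ}e^{(t/2)Δ}`, the weighted Hölder gradient gain on the inner factor and the weight-one
  bounded-data gradient bound on the outer one.  This is the domination the X-scale needs from Hölder data
  (`∫₀^∞ e^{-s} τ_s^{-1+β/2} ds < ∞`).
-/

set_option linter.dupNamespace false

noncomputable section

namespace Summit.NavierStokesRegularity.NavierStokesRegularity.Theorems.KelvinGate

open Set Function Filter MeasureTheory Metric Real
open Literature.Analysis.UnboundedOperators
open scoped ENNReal Topology

section WeightOneTwo

variable {E : Type*} [NormedAddCommGroup E] [InnerProductSpace ℝ E] [FiniteDimensional ℝ E]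
  [MeasurableSpace E] [BorelSpace E]
variable {F : Type*} [NormedAddCommGroup F] [NormedSpace ℝ F] [CompleteSpace F]

/-- **Weighted Hölder gain of the second derivative**: `(1+|x|)‖D²e^{tΔ}g(x)‖ ≤
(2c(t/2)^{-1/2} + √2cc′)·(c(t/2)^{-1/2}c′t^{β/2}A₁ + 4√2cc′A₀)` (`c = 2^{n/2}`, `c′ = 1+2c`). -/
theorem weight_norm_fderiv_fderiv_heatExtension_le_of_local_holder {g : E → F} (hgc : Continuous g) {A₀ A₁ β : ℝ}
    (hA₁ : 0 ≤ A₁) (hβ0 : 0 ≤ β) (hβ1 : β ≤ 1) (h0 : ∀ z, (1 + ‖z‖) * ‖g z‖ ≤ A₀)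
    (h1 : ∀ x z, 2 * ‖z - x‖ ≤ 1 + ‖x‖ → (1 + ‖x‖) * ‖g z - g x‖ ≤ A₁ * ‖z - x‖ ^ β)
    {t : ℝ} (ht : 0 < t) (x : E) :
    (1 + ‖x‖) * ‖fderiv ℝ (fderiv ℝ (heatExtension g t)) x‖ ≤
      (2 * (2 : ℝ) ^ ((Module.finrank ℝ E : ℝ) / 2) * (t / 2) ^ (-(1 / 2 : ℝ)) +
        (2 : ℝ) ^ (1 / 2 : ℝ) * (2 : ℝ) ^ ((Module.finrank ℝ E : ℝ) / 2) *
          (1 + 2 * (2 : ℝ) ^ ((Module.finrank ℝ E : ℝ) / 2))) *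
      ((2 : ℝ) ^ ((Module.finrank ℝ E : ℝ) / 2) * (t / 2) ^ (-(1 / 2 : ℝ)) *
          ((1 + 2 * (2 : ℝ) ^ ((Module.finrank ℝ E : ℝ) / 2)) * t ^ (β / 2)) * A₁ +
        4 * ((2 : ℝ) ^ (1 / 2 : ℝ) * (2 : ℝ) ^ ((Module.finrank ℝ E : ℝ) / 2) *
          (1 + 2 * (2 : ℝ) ^ ((Module.finrank ℝ E : ℝ) / 2))) * A₀) := by
  have hA₀ : 0 ≤ A₀ := le_trans (by positivity) (h0 0)
  have hC : ∀ z, ‖g z‖ ≤ A₀ := fun z => by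
    have := h0 z; nlinarith [norm_nonneg (g z), norm_nonneg z]
  have ht2 : 0 < t / 2 := by positivity
  have hmem : MemLp g ∞ (volume : Measure E) := memLp_top_of_continuous_of_bound hgc hC
  -- `H = e^{(t/2)Δ}g`, `e^{tΔ}g = e^{(t/2)Δ}H`
  set H : E → F := heatExtension g (t / 2) with hH
  have hsemi : heatExtension g t = heatExtension H (t / 2) := by
    rw [hH, heatExtension_add_holds hmem le_top ht2 ht2]; congr 1; ring
  have hHc : ContDiff ℝ 1 H := contDiff_heatExtension_of_bound hgc hC ht2
  have hH0 : ∀ z, ‖H z‖ ≤ A₀ := fun z => norm_heatExtension_le_of_bound hC ht2 z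
  have hH1 : ∀ z, ‖fderiv ℝ H z‖ ≤ (2 : ℝ) ^ ((Module.finrank ℝ E : ℝ) / 2) * (t / 2) ^ (-(1 / 2 : ℝ)) * A₀ :=
    fun z => norm_fderiv_heatExtension_le_of_bounded hgc.aestronglyMeasurable hC ht2 z
  have hfun : fderiv ℝ (heatExtension g t) = heatExtension (fderiv ℝ H) (t / 2) := by
    rw [hsemi]; exact funext fun z => fderiv_heatExtension_of_bounded hHc hH0 hH1 ht2 z
  rw [hfun]
  -- the inner factor: weighted Hölder gradient gain at time `t/2`
  have hDHc : Continuous (fderiv ℝ H) := hHc.continuous_fderiv one_ne_zero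
  have hinner : ∀ z, (1 + ‖z‖) * ‖fderiv ℝ H z‖ ≤
      (2 : ℝ) ^ ((Module.finrank ℝ E : ℝ) / 2) * (t / 2) ^ (-(1 / 2 : ℝ)) *
          ((1 + 2 * (2 : ℝ) ^ ((Module.finrank ℝ E : ℝ) / 2)) * t ^ (β / 2)) * A₁ +
        4 * ((2 : ℝ) ^ (1 / 2 : ℝ) * (2 : ℝ) ^ ((Module.finrank ℝ E : ℝ) / 2) *
          (1 + 2 * (2 : ℝ) ^ ((Module.finrank ℝ E : ℝ) / 2))) * A₀ := by
    intro z
    have h := weight_norm_fderiv_heatExtension_le_of_local_holder hgc hA₁ hβ0 hβ1 h0 h1 ht2 z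
    rwa [show 2 * (t / 2) = t by ring] at h
  -- the outer factor: weight-one gradient bound for the bounded weighted datum `DH`
  exact weight_norm_fderiv_heatExtension_le (f := fderiv ℝ H) hDHc hinner ht2 x

end WeightOneTwo

end Summit.NavierStokesRegularity.NavierStokesRegularity.Theorems.KelvinGate

end
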